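import Summits.QuantumFields.BalabanUV.Beta.D1BFx.NeedleDipShape
import Summits.QuantumFields.BalabanUV.Beta.D1BFx.GluonLegProfile
import Summits.QuantumFields.BalabanUV.Beta.D1BFx.GluonLegProfileD1
import Summits.QuantumFields.BalabanUV.Beta.D1BFx.ProjectorMixedDiff
import Summits.QuantumFields.BalabanUV.Beta.D1BFx.PairingByParts

/-!
# `BalabanUV.Beta.D1BFx.NeedleDipDipLetters` — road «BF-x» for binder row D1, slot (K), END row `hGrp gN`, «KK-LETTERS»: THE COMMON-RATE LETTER PACK OF THE
# `dip ⊗ dip` CELL — the gluon leg's entry ∕ backward-d1 letters and the four functions' letters (`∇p` flat `n⁻⁵`, `∇δp` flat `n⁻⁶`, `∇ρ` Coulomb `n⁻²∕nrm³`,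
# `δρ` dipole `n⁻²∕nrm³`) at ONE site rate `ε₀∕n`, `0 < ε₀ ≤ 1`, at every bond, modulo [B5, Prop. 1.2] ∧ [B5, (1.126)–(1.127)] BY NAME

HONEST DEPENDENCY (cell records, verbatim): «continuum YM on T⁴ ⇐ BetaPertH ∧ nine spine estimates (0/9 proved); BetaPertH ⇐ (D1) ∧ (D4) ∧
CAP+tail; G-an2-4 gates asym, D1 and NE2/3/4.»  HONEST FRAMING (cell contract, verbatim): «discharging `BetaPertH` makes Bałaban's UV stability
UNCONDITIONAL — a real constructive-QFT result; it is NOT the continuum limit and NOT the Clay problem.»  THIS MODULE DISCHARGES NOTHING of the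
wall: [folklore] repackaging BY NAME of `GluonLegProfile.exists_abs_Ga_le_profile`, `GluonLegProfileD1.exists_abs_Ga_diff(_left)_le_profile` (leaf-04-g9),
`ProjectorSupNorm.abs_Pgt_diff_right_le_sup` (leaf-05), `ProjectorMixedDiff.abs_Pgt_diff_diff_le_sup` (leaf-04-g9), `RColumnProfile.abs_RG_diff_le_profile`,
`RColumnProfileDipole.abs_RG_right_diff_le_profile` (gan24-leaf-05) and the one-step shifts of `PairingByParts` at the smallest of all rates (block decay
turned into site damping by `RColumnProfile.supNorm_sub_succ_le`).  No `def`, no `def … : Prop`, nothing cited, 0 sorry; the printed statements enter as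
HYPOTHESES `h12`∕`h126`.  Root-level binders hW ∕ hR-sockets ∕ hSX-socket ∕ D1Tel ∕ D1Rep — 0 discharged; (K) NOT closed; NOT D1, NOT `BetaPertH`, NOT
continuum, NOT Clay.

CONTENT (`a > 0`).
* §1 [folklore] `exp_blockDecay_le_siteDamped` (`e^{−δ·dist(blk u, blk y)} ≤ e^{δ}·e^{−(δ∕n)‖y−u‖∞}`), `exp_rate_mono` (weakening a site rate).
* §2 [folklore] **`exists_legLetters`** — `∃ ε₁ kA kA₁, …, ∀ ε₀ ≤ ε₁, ∀ n`: `|Ga(x,y)| ≤ kA·e∕nrm²`, `|Ga(x,y−e_b)| ≤ 4e·kA·e∕nrm²`, the two backward d1 letters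
  `kA₁e∕nrm³`, all at rate `ε₀∕n`.
* §3 [folklore] **`exists_functionLetters`** — `∃ ε₂ cF kR, …, ∀ ε₀ ≤ ε₂, ∀ n u κ`: `|∇p_u| ≤ cF∕n⁵·e`, `|∇δp_{u,κ}| ≤ cF∕n⁶·e` (flat), `|∇ρ_u| ≤ kR∕n²·e∕nrm³`,
  `|δρ_{u,κ}| ≤ kR∕n²·e∕nrm³`, at rate `ε₀∕n`.
Unit `b2b-balaban-beta-d1-formalise-leaf-04` (gen 9); `LEAVES-BFx.md` row (N) «KK-LETTERS».
-/

noncomputable section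

namespace Summit.QuantumFields.BalabanUV.Beta.D1BFx.NeedleDipDipLetters

open Finset
open scoped BigOperators
open Literature.MathematicalPhysics.QuantumFieldTheory.Balaban1983to89
open Literature.MathematicalPhysics.QuantumFieldTheory.Balaban1983to89.Beta
open B6QGQLower276 (X e blk B mem_B)
open ExpKernelCalculus (Site MKer)
open DyadicShell (Pt)
open AffineAveraging (unitVec)
open VectorTailsLoc (fam kfam)
open PoissonInterior (nrm nrm_pos one_le_nrm nrm_neg supNorm supNorm_neg supNorm_le_nrm)
open Summit.QuantumFields.BalabanUV.Beta.D1BFx.RProjector (Pgt deltaPP deltaPP_pos)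
open Summit.QuantumFields.BalabanUV.Beta.D1BFx.ProjectorSupNorm (cPPs cPPs_nonneg abs_Pgt_diff_right_le_sup)
open Summit.QuantumFields.BalabanUV.Beta.D1BFx.ProjectorMixedDiff (abs_Pgt_diff_diff_le_sup)
open Summit.QuantumFields.BalabanUV.Beta.D1BFx.GhostLeg (Ggh)
open Summit.QuantumFields.BalabanUV.Beta.D1BFx.RProjectorJet (RG)
open Summit.QuantumFields.BalabanUV.Beta.D1BFx.GluonLeg (Ga)
open Summit.QuantumFields.BalabanUV.Beta.D1BFx.GluonLegProfile (exists_abs_Ga_le_profile)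
open Summit.QuantumFields.BalabanUV.Beta.D1BFx.GluonLegProfileD1 (exists_abs_Ga_diff_le_profile exists_abs_Ga_diff_left_le_profile)
open Summit.QuantumFields.BalabanUV.Beta.D1BFx.FrozenLegTails (nOf MOf hn1)
open Summit.QuantumFields.BalabanUV.Beta.D1BFx.RColumnBlockMass (dR dR_pos)
open Summit.QuantumFields.BalabanUV.Beta.D1BFx.RColumnProfile (kV kP kV_nonneg_and abs_RG_diff_le_profile supNorm_sub_succ_le)
open Summit.QuantumFields.BalabanUV.Beta.D1BFx.RColumnProfileDipole (kD kD_nonneg abs_RG_right_diff_le_profile)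
open Summit.QuantumFields.BalabanUV.Beta.D1BFx.GhostLegFree (supNorm_eq)
open Summit.QuantumFields.BalabanUV.Beta.D1BFx.RankOneBubbleJets (grad grad_apply)
open Summit.QuantumFields.BalabanUV.Beta.D1BFx.PairingByParts (abs_sub_left_le_of_letter abs_sub_right_le_of_letter abs_shift_right_le_of_letter)

variable (a : ℝ) (ha : 0 < a)

/-! ## §1 Block decay as site damping; weakening a rate -/

/-- [folklore] **BLOCK DECAY ⟹ SITE DAMPING**: `e^{−δ·dist(blk u, blk y)} ≤ e^{δ}·e^{−(δ∕n)‖y−u‖∞}` for `δ ≥ 0` (`‖y−u‖∞ + 1 ≤ n·(dist + 1)`,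
`RColumnProfile.supNorm_sub_succ_le`). -/
theorem exp_blockDecay_le_siteDamped (n : ℕ) [NeZero n] {δ : ℝ} (hδ : 0 ≤ δ) (u y : Pt) :
    Real.exp (-(δ * dist (blk (n - 1) u) (blk (n - 1) y))) ≤ Real.exp δ * Real.exp (-(δ / n) * supNorm (d := 4) (y - u)) := by
  have hn : (0 : ℝ) < n := by exact_mod_cast Nat.pos_of_ne_zero (NeZero.ne n)
  have h := supNorm_sub_succ_le n y u
  rw [supNorm_eq] at h
  rw [dist_comm, ← Real.exp_add, Real.exp_le_exp]
  -- `(δ/n)(‖y−u‖+1) ≤ δ(dist+1)`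
  have h1 : δ / n * ((supNorm (d := 4) (y - u) : ℝ) + 1) ≤ δ * (dist (blk (n - 1) y) (blk (n - 1) u) + 1) := by
    rw [div_mul_eq_mul_div, div_le_iff₀ hn]
    calc δ * ((supNorm (d := 4) (y - u) : ℝ) + 1) ≤ δ * ((n : ℝ) * (dist (blk (n - 1) y) (blk (n - 1) u) + 1)) :=
          mul_le_mul_of_nonneg_left h hδ
      _ = δ * (dist (blk (n - 1) y) (blk (n - 1) u) + 1) * n := by ring
  have h2 : (0 : ℝ) ≤ δ / n := by positivity
  nlinarith

/-- [folklore] weakening a site rate: `e^{−(r∕n)·s} ≤ e^{−(ε₀∕n)·s}` for `ε₀ ≤ r`, `s ≥ 0`. -/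
theorem exp_rate_mono (n : ℕ) {ε₀ r : ℝ} (h : ε₀ ≤ r) (s : ℕ) :
    Real.exp (-(r / n) * s) ≤ Real.exp (-(ε₀ / n) * s) := by
  rw [Real.exp_le_exp]
  have hn : (0 : ℝ) ≤ (n : ℝ)⁻¹ := inv_nonneg.mpr (Nat.cast_nonneg n)
  have hs : (0 : ℝ) ≤ s := Nat.cast_nonneg s
  have : ε₀ / n * s ≤ r / n * s := by
    rw [div_eq_mul_inv, div_eq_mul_inv]
    exact mul_le_mul_of_nonneg_right (mul_le_mul_of_nonneg_right h hn) hs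
  linarith

/-! ## §2 The gluon leg's letters at a common rate -/

/-- [folklore] **THE LEG LETTERS AT ANY RATE BELOW `ε₁`**, modulo [B5, Prop. 1.2] ∧ [B5, (1.126)–(1.127)] BY NAME: `∃ ε₁ kA kA₁` (`0 < ε₁ ≤ 1`, `kA, kA₁ ≥ 0`)
with, for every `0 < ε₀ ≤ ε₁` and every `n ≥ 1`: the entry letter `|Ga(x,y)_{cb}| ≤ kA·e^{−(ε₀∕n)‖x−y‖}∕nrm(x−y)²`, its second-site shift
`|Ga(x,y−e_b)_{cb}| ≤ 4e·kA·(…)`, and the two backward d1 letters `|Ga(x,y−e_b) − Ga(x,y)|, |Ga(x−e_a,y)_{ab} − Ga(x,y)_{ab}| ≤ kA₁·e^{−(ε₀∕n)‖x−y‖}∕nrm(x−y)³`. -/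
theorem exists_legLetters (h12 : B5.Prop12Printed (fam nOf hn1 MOf a ha)) (h126 : B5.Kernel126_127Printed (kfam nOf MOf)) :
    ∃ ε₁ kA kA₁ : ℝ, 0 < ε₁ ∧ ε₁ ≤ 1 ∧ 0 ≤ kA ∧ 0 ≤ kA₁ ∧ ∀ ε₀ : ℝ, 0 < ε₀ → ε₀ ≤ ε₁ → ∀ (n : ℕ) [NeZero n],
      (∀ (x y : Site 4) (c b : Fin 4), |Ga n a x y c b| ≤ kA * Real.exp (-(ε₀ / n) * supNorm (x - y)) / nrm (x - y) ^ 2) ∧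
      (∀ (x y : Site 4) (c b : Fin 4), |Ga n a x (y - unitVec b) c b| ≤
        4 * Real.exp 1 * kA * Real.exp (-(ε₀ / n) * supNorm (x - y)) / nrm (x - y) ^ 2) ∧
      (∀ (x y : Site 4) (c b : Fin 4), |Ga n a x (y - unitVec b) c b - Ga n a x y c b| ≤
        kA₁ * Real.exp (-(ε₀ / n) * supNorm (x - y)) / nrm (x - y) ^ 3) ∧
      (∀ (x y : Site 4) (a' b : Fin 4), |Ga n a (x - unitVec a') y a' b - Ga n a x y a' b| ≤
        kA₁ * Real.exp (-(ε₀ / n) * supNorm (x - y)) / nrm (x - y) ^ 3) := by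
  obtain ⟨kG, δ₀, hδ₀, hkG, h0⟩ := exists_abs_Ga_le_profile a ha h12 h126
  obtain ⟨kG', δ₁, hδ₁, hkG', h1⟩ := exists_abs_Ga_diff_le_profile a ha h12 h126
  obtain ⟨kG'', δ₂, hδ₂, hkG'', h2⟩ := exists_abs_Ga_diff_left_le_profile a ha h12 h126
  set ε₁ : ℝ := min 1 (min δ₀ (min δ₁ δ₂)) with hε₁
  have hε₁0 : 0 < ε₁ := lt_min one_pos (lt_min hδ₀ (lt_min hδ₁ hδ₂))
  set kM : ℝ := max kG' kG'' with hkM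
  have hkM0 : 0 ≤ kM := hkG'.trans (le_max_left _ _)
  refine ⟨ε₁, kG, 8 * Real.exp 1 * kM, hε₁0, min_le_left _ _, hkG, by positivity, fun ε₀ hε₀ hε₀1 n _ => ?_⟩
  have hn : (0 : ℝ) < n := by exact_mod_cast Nat.pos_of_ne_zero (NeZero.ne n)
  have hn1 : (1 : ℝ) ≤ n := by exact_mod_cast NeZero.one_le
  have hεδ₀ : ε₀ ≤ δ₀ := hε₀1.trans ((min_le_right _ _).trans (min_le_left _ _))
  have hεδ₁ : ε₀ ≤ δ₁ := hε₀1.trans ((min_le_right _ _).trans ((min_le_right _ _).trans (min_le_left _ _)))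
  have hεδ₂ : ε₀ ≤ δ₂ := hε₀1.trans ((min_le_right _ _).trans ((min_le_right _ _).trans (min_le_right _ _)))
  have hε1 : ε₀ / n ≤ 1 := by
    rw [div_le_one hn]; exact (hε₀1.trans (min_le_left _ _)).trans hn1
  have hεn : 0 ≤ ε₀ / n := by positivity
  -- the entry letter at rate ε₀/n
  have hA0 : ∀ (x y : Site 4) (c b : Fin 4), |Ga n a x y c b| ≤ kG * Real.exp (-(ε₀ / n) * supNorm (x - y)) / nrm (x - y) ^ 2 := by
    intro x y c b
    refine (h0 n x y c b).trans ?_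
    rw [← neg_sub x y, supNorm_neg, nrm_neg]
    exact div_le_div_of_nonneg_right (mul_le_mul_of_nonneg_left (exp_rate_mono n hεδ₀ _) hkG) (pow_pos (nrm_pos _) 2).le
  -- the forward d1 letters at rate ε₀/n with the common constant kM
  have hA1f : ∀ (x y : Site 4) (c b β : Fin 4), |Ga n a x (y + unitVec β) c b - Ga n a x y c b| ≤
      kM * Real.exp (-(ε₀ / n) * supNorm (x - y)) / nrm (x - y) ^ 3 := by
    intro x y c b β
    refine (h1 n x y c b β).trans ?_
    rw [← neg_sub x y, supNorm_neg, nrm_neg]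
    exact div_le_div_of_nonneg_right (mul_le_mul (le_max_left _ _) (exp_rate_mono n hεδ₁ _) (Real.exp_pos _).le hkM0)
      (pow_pos (nrm_pos _) 3).le
  have hA1f' : ∀ (x y : Site 4) (c b β : Fin 4), |Ga n a (x + unitVec β) y c b - Ga n a x y c b| ≤
      kM * Real.exp (-(ε₀ / n) * supNorm (x - y)) / nrm (x - y) ^ 3 := by
    intro x y c b β
    refine (h2 n x y c b β).trans ?_
    exact div_le_div_of_nonneg_right (mul_le_mul (le_max_right _ _) (exp_rate_mono n hεδ₂ _) (Real.exp_pos _).le hkM0)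
      (pow_pos (nrm_pos _) 3).le
  refine ⟨hA0, fun x y c b => ?_, fun x y c b => ?_, fun x y a' b => ?_⟩
  · exact abs_shift_right_le_of_letter hkG hεn hε1 hA0 x y c b
  · exact abs_sub_right_le_of_letter hkM0 hεn hε1 hA1f x y c b
  · exact abs_sub_left_le_of_letter hkM0 hεn hε1 hA1f' x y a' b

/-! ## §3 The four functions' letters at a common rate -/

/-- [folklore] **THE FUNCTION LETTERS AT ANY RATE BELOW `ε₂`** (`a > 0`, no printed hypothesis): `∃ ε₂ cF kR` (`0 < ε₂ ≤ 1`, `cF, kR ≥ 0`) with, for every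
`0 < ε₀ ≤ ε₂`, `n ≥ 1`, bond `(u, κ)`: the flat gradient letters `|∇p_u(y,b)| ≤ cF∕n⁵·e^{−(ε₀∕n)‖y−u‖}`, `|∇δp_{u,κ}(y,b)| ≤ cF∕n⁶·e^{−(ε₀∕n)‖y−u‖}`
(`ProjectorSupNorm.abs_Pgt_diff_right_le_sup`, `ProjectorMixedDiff.abs_Pgt_diff_diff_le_sup`, block decay ↦ site damping), the Coulomb gradient letter
`|∇ρ_u(x,a)| ≤ kR∕n²·e^{−(ε₀∕n)‖x−u‖}∕nrm(x−u)³` (`RColumnProfile.abs_RG_diff_le_profile`) and the dipole letter `|δρ_{u,κ}(x)| ≤ kR∕n²·e∕nrm(x−u)³`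
(`RColumnProfileDipole.abs_RG_right_diff_le_profile`). -/
theorem exists_functionLetters (ha0 : 0 < a) :
    ∃ ε₂ cF kR : ℝ, 0 < ε₂ ∧ ε₂ ≤ 1 ∧ 0 ≤ cF ∧ 0 ≤ kR ∧ ∀ ε₀ : ℝ, 0 < ε₀ → ε₀ ≤ ε₂ → ∀ (n : ℕ) [NeZero n] (u : Site 4) (κ : Fin 4),
      (∀ (y : Site 4) (b : Fin 4), |grad (fun q => Pgt n a u q () ()) y b| ≤ cF / (n : ℝ) ^ 5 * Real.exp (-(ε₀ / n) * supNorm (y - u))) ∧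
      (∀ (y : Site 4) (b : Fin 4), |grad (fun q => Pgt n a u q () () - Pgt n a (u + unitVec κ) q () ()) y b| ≤
        cF / (n : ℝ) ^ 6 * Real.exp (-(ε₀ / n) * supNorm (y - u))) ∧
      (∀ (x : Site 4) (a' : Fin 4), |grad (fun x => RG (Ggh n a) (Pgt n a) x u () ()) x a'| ≤
        kR / (n : ℝ) ^ 2 * Real.exp (-(ε₀ / n) * supNorm (x - u)) / nrm (x - u) ^ 3) ∧
      (∀ x : Site 4, |RG (Ggh n a) (Pgt n a) x (u + unitVec κ) () () - RG (Ggh n a) (Pgt n a) x u () ()| ≤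
        kR / (n : ℝ) ^ 2 * Real.exp (-(ε₀ / n) * supNorm (x - u)) / nrm (x - u) ^ 3) := by
  have hPP := deltaPP_pos 4 ha0
  have hdR := dR_pos ha0
  set ε₂ : ℝ := min 1 (min (deltaPP 4 a) (dR a / 2)) with hε₂
  have hε₂0 : 0 < ε₂ := lt_min one_pos (lt_min hPP (half_pos hdR))
  have hc := cPPs_nonneg 4 ha0
  have hkP := (kV_nonneg_and ha0).2
  have hkD := kD_nonneg ha0
  refine ⟨ε₂, cPPs 4 a * Real.exp (deltaPP 4 a), max (kP a) (kD a), hε₂0, min_le_left _ _, by positivity, hkP.trans (le_max_left _ _),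
    fun ε₀ hε₀ hε₀2 n _ u κ => ?_⟩
  have hn : (0 : ℝ) < n := by exact_mod_cast Nat.pos_of_ne_zero (NeZero.ne n)
  have hεP : ε₀ ≤ deltaPP 4 a := hε₀2.trans ((min_le_right _ _).trans (min_le_left _ _))
  have hεR : ε₀ ≤ dR a / 2 := hε₀2.trans ((min_le_right _ _).trans (min_le_right _ _))
  -- block decay at rate δ_PP ↦ site damping at rate ε₀/n
  have hblk : ∀ y : Site 4, Real.exp (-(deltaPP 4 a * dist (blk (n - 1) u) (blk (n - 1) y)))
      ≤ Real.exp (deltaPP 4 a) * Real.exp (-(ε₀ / n) * supNorm (y - u)) := fun y =>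
    (exp_blockDecay_le_siteDamped n hPP.le u y).trans (mul_le_mul_of_nonneg_left (exp_rate_mono n hεP _) (Real.exp_pos _).le)
  refine ⟨fun y b => ?_, fun y b => ?_, fun x a' => ?_, fun x => ?_⟩
  · rw [grad_apply]
    have h := abs_Pgt_diff_right_le_sup n ha0 u y b () ()
    rw [show (e b : Pt) = unitVec b from rfl] at h
    refine h.trans ?_
    calc cPPs 4 a / (n : ℝ) ^ 5 * Real.exp (-(deltaPP 4 a * dist (blk (n - 1) u) (blk (n - 1) y)))
        ≤ cPPs 4 a / (n : ℝ) ^ 5 * (Real.exp (deltaPP 4 a) * Real.exp (-(ε₀ / n) * supNorm (y - u))) :=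
          mul_le_mul_of_nonneg_left (hblk y) (by positivity)
      _ = cPPs 4 a * Real.exp (deltaPP 4 a) / (n : ℝ) ^ 5 * Real.exp (-(ε₀ / n) * supNorm (y - u)) := by ring
  · rw [grad_apply]
    have h := abs_Pgt_diff_diff_le_sup n ha0 u y κ b () ()
    rw [show (e b : Pt) = unitVec b from rfl, show (e κ : Pt) = unitVec κ from rfl] at h
    have e1 : Pgt n a u (y + unitVec b) () () - Pgt n a (u + unitVec κ) (y + unitVec b) () () - (Pgt n a u y () () - Pgt n a (u + unitVec κ) y () ())
        = -(Pgt n a (u + unitVec κ) (y + unitVec b) () () - Pgt n a (u + unitVec κ) y () () - Pgt n a u (y + unitVec b) () () + Pgt n a u y () ()) := by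
      ring
    rw [e1, abs_neg]
    refine h.trans ?_
    calc cPPs 4 a / (n : ℝ) ^ 6 * Real.exp (-(deltaPP 4 a * dist (blk (n - 1) u) (blk (n - 1) y)))
        ≤ cPPs 4 a / (n : ℝ) ^ 6 * (Real.exp (deltaPP 4 a) * Real.exp (-(ε₀ / n) * supNorm (y - u))) :=
          mul_le_mul_of_nonneg_left (hblk y) (by positivity)
      _ = cPPs 4 a * Real.exp (deltaPP 4 a) / (n : ℝ) ^ 6 * Real.exp (-(ε₀ / n) * supNorm (y - u)) := by ring
  · rw [grad_apply]
    refine (abs_RG_diff_le_profile n ha0 x u a').trans ?_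
    have e1 : dR a / 2 / (n : ℝ) = (dR a / 2) / n := rfl
    refine div_le_div_of_nonneg_right ?_ (pow_pos (nrm_pos _) 3).le
    exact mul_le_mul (div_le_div_of_nonneg_right (le_max_left _ _) (by positivity)) (exp_rate_mono n hεR _) (Real.exp_pos _).le
      (div_nonneg (hkP.trans (le_max_left _ _)) (by positivity))
  · refine (abs_RG_right_diff_le_profile n ha0 x u κ).trans ?_
    refine div_le_div_of_nonneg_right ?_ (pow_pos (nrm_pos _) 3).le
    exact mul_le_mul (div_le_div_of_nonneg_right (le_max_right _ _) (by positivity)) (exp_rate_mono n hεR _) (Real.exp_pos _).le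
      (div_nonneg (hkP.trans (le_max_left _ _)) (by positivity))

end Summit.QuantumFields.BalabanUV.Beta.D1BFx.NeedleDipDipLetters

end
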